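import Literature.Analysis.FluidPDE.InfiniteHardSphereDynamics
import Literature.Analysis.FunctionSpaces.PoissonMeckePrelims
import Literature.MathematicalPhysics.StatisticalMechanics.HardSphereConditionalEquilibrium
import Mathlib.MeasureTheory.Measure.GiryMonad

/-!
# Hard-sphere Gibbs specifications in phase space: measurability (Richthammer's §3.6 in `ℝᵈ × ℝᵈ`)

Helper file (Core, 1/2) of crux stmt-AtomisticToContinuum-14135 `AntiMazurCoboundaries.CorrectorPressureDecay`, line
`FirstLemma` (idea `kifer-compactification`), namespace `…Theorems.KiferCompactification`; registered stub
`stub_measurable_superposeIn_hardCoreIn`; serves the wall sanity check `stub_gibbsFastBiasVanishes`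
(`…KiferWallGibbsSanity.lean`). Every manipulation of the DLR equation `μ A = ∫⁻ Y, γ_Λ(A | Y) ∂μ` of
`Literature.Analysis.FluidPDE.IsHardSphereGibbs` beyond indicators needs the boundary condition `Y ↦ γ_Λ(A | Y)` to be
measurable (Richthammer 2007 §3.6 Lemma 6 / §4.4, there for planar hard discs; here in phase space, general dimension):

* `measurableSet_hardCoreIn` — the hard-core event `{X | HardCoreIn ε Λ X}` is measurable (Campbell sum of occupation
  events `∑_{p ∈ X} 1_Λ(p.1) 1{N_{B(p)}(X) ≥ 2}`);
* `measurable_superposeIn` — `(x, Y) ↦ superposeIn Λ x Y = (x ∩ Λ) ∪ (Y ∩ Λᶜ)` is jointly measurable (its counts split);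
* combinatorics of a superposition above the window: `count_superposeIn_prod_univ_le` (at most `k` particles above `Λ`),
  `particlesIn_superposeIn_eq_range`, `hardCoreIn_superposeIn_iff` (the hard core in coordinates).
-/

noncomputable section

open MeasureTheory ProbabilityTheory Set Filter Topology Function
open scoped ENNReal

namespace Summit.AtomisticToContinuum.HydrodynamicLimit.Theorems.KiferCompactification

open Literature.Analysis.FluidPDE (IsHardSphereGibbs HardCoreIn superposeIn gibbsWeight gibbsSpec maxwellPhaseMeasure
  particlesIn mem_particlesIn_iff)
open Literature.Analysis.FunctionSpaces (PointConfig)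
open Literature.MathematicalPhysics.KineticTheory (V3)

section HardCoreMeasurability

/-- Negation of the hard-core constraint in the window `Λ`: some particle with position in `Λ` has another particle
at position-distance `< ε`. -/
theorem not_hardCoreIn_iff (ε : ℝ) (Λ : Set V3) (X : PointConfig (V3 × V3)) :
    ¬ HardCoreIn ε Λ X ↔ ∃ p ∈ X, p.1 ∈ Λ ∧ ∃ q ∈ X, q ≠ p ∧ ‖p.1 - q.1‖ < ε := by
  constructor
  · intro h
    simp only [HardCoreIn, not_forall, not_le, exists_prop] at h
    obtain ⟨p, hp, q, hq, hpq, hΛ, hd⟩ := h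
    rcases hΛ with hpΛ | hqΛ
    · exact ⟨p, hp, hpΛ, q, hq, Ne.symm hpq, hd⟩
    · exact ⟨q, hq, hqΛ, p, hp, hpq, by rwa [norm_sub_rev]⟩
  · rintro ⟨p, hp, hpΛ, q, hq, hqp, hd⟩ h
    exact absurd (h p hp q hq (Ne.symm hqp) (Or.inl hpΛ)) (not_le.2 hd)

/-- `N_s(X) ≥ 2` iff `X` has two distinct points in `s`. -/
private theorem two_le_count_iff' (X : PointConfig (V3 × V3)) (s : Set (V3 × V3)) :
    2 ≤ X.count s ↔ ∃ a ∈ X, ∃ b ∈ X, a ∈ s ∧ b ∈ s ∧ a ≠ b := by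
  rw [PointConfig.count, ← (one_add_one_eq_two : (1 : ℕ∞) + 1 = 2), ENat.add_one_le_iff ENat.one_ne_top,
    Set.one_lt_encard_iff]
  simp only [mem_inter_iff, PointConfig.mem_carrier]
  constructor
  · rintro ⟨a, b, ⟨ha, has⟩, ⟨hb, hbs⟩, hab⟩
    exact ⟨a, ha, b, hb, has, hbs, hab⟩
  · rintro ⟨a, ha, b, hb, has, hbs, hab⟩
    exact ⟨a, b, ⟨ha, has⟩, ⟨hb, hbs⟩, hab⟩

/-- **The hard-core event `{X | HardCoreIn ε Λ X}` is measurable** for measurable `Λ` (count σ-algebra): its complement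
is `{X | ∑_{p ∈ X} 1_Λ(p.1) 1{N_{B(p)}(X) ≥ 2} ≠ 0}`, `B(p) = {q | ‖p.1 − q.1‖ < ε}`, a Campbell sum of occupation
events (Richthammer 2007 §4.4, in phase space). -/
theorem measurableSet_hardCoreIn (ε : ℝ) {Λ : Set V3} (hΛ : MeasurableSet Λ) :
    MeasurableSet {X : PointConfig (V3 × V3) | HardCoreIn ε Λ X} := by
  set B : Set ((PointConfig (V3 × V3) × (V3 × V3)) × (V3 × V3)) := {r | ‖r.1.2.1 - r.2.1‖ < ε} with hB
  have hball : MeasurableSet B :=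
    measurableSet_lt ((measurable_snd.comp measurable_fst).fst.sub measurable_snd.fst).norm measurable_const
  have hF : Measurable fun a : PointConfig (V3 × V3) × (V3 × V3) => a.1.toMeasure (Prod.mk a ⁻¹' B) :=
    PointConfig.measurable_toMeasure_preimage hball measurable_fst
  set S : Set (PointConfig (V3 × V3) × (V3 × V3)) := {a | a.2.1 ∈ Λ ∧ 2 ≤ a.1.toMeasure (Prod.mk a ⁻¹' B)} with hS
  have hSm : MeasurableSet S := (hΛ.preimage measurable_snd.fst).inter (measurableSet_le measurable_const hF)
  have hT : Measurable fun X : PointConfig (V3 × V3) =>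
      ∑' p : ((X : PointConfig (V3 × V3)) : Set (V3 × V3)), S.indicator 1 (X, (p : V3 × V3)) :=
    PointConfig.measurable_tsum_carrier (measurable_one.indicator hSm) measurable_id
  have hcount : ∀ (X : PointConfig (V3 × V3)) (p : V3 × V3),
      X.toMeasure (Prod.mk (X, p) ⁻¹' B) = X.count {q | ‖p.1 - q.1‖ < ε} := fun X p => by
    rw [PointConfig.toMeasure_apply _ (measurable_prodMk_left hball)]
    rfl
  have hmemS : ∀ (X : PointConfig (V3 × V3)) (p : V3 × V3), p ∈ X →
      ((X, p) ∈ S ↔ p.1 ∈ Λ ∧ ∃ q ∈ X, q ≠ p ∧ ‖p.1 - q.1‖ < ε) := fun X p hp => by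
    rw [hS, mem_setOf_eq, hcount]
    refine and_congr Iff.rfl ?_
    have hcast : (2 : ℝ≥0∞) ≤ (X.count {q | ‖p.1 - q.1‖ < ε} : ℝ≥0∞) ↔ 2 ≤ X.count {q | ‖p.1 - q.1‖ < ε} := by
      norm_cast
    rw [hcast, two_le_count_iff']
    constructor
    · rintro ⟨a, ha, b, hb, had, hbd, hab⟩
      simp only [mem_setOf_eq] at had hbd
      by_cases hap : a = p
      · subst hap
        exact ⟨b, hb, Ne.symm hab, hbd⟩
      · exact ⟨a, ha, hap, had⟩
    · rintro ⟨q, hq, hqp, hd⟩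
      by_cases hε : 0 < ε
      · exact ⟨p, hp, q, hq, by simp [hε], hd, hqp.symm⟩
      · exact absurd ((norm_nonneg _).trans_lt hd) hε
  have key : {X : PointConfig (V3 × V3) | HardCoreIn ε Λ X} =
      {X | ∑' p : ((X : PointConfig (V3 × V3)) : Set (V3 × V3)),
        S.indicator (1 : PointConfig (V3 × V3) × (V3 × V3) → ℝ≥0∞) (X, (p : V3 × V3)) = 0} := by
    ext X
    simp only [mem_setOf_eq, ENNReal.tsum_eq_zero, Set.indicator_apply_eq_zero, Pi.one_apply, one_ne_zero,
      imp_false, Subtype.forall]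
    rw [← not_iff_not, not_hardCoreIn_iff]
    push Not
    constructor
    · rintro ⟨p, hp, hpΛ, q, hq, hqp, hd⟩
      exact ⟨p, hp, (hmemS X p hp).2 ⟨hpΛ, q, hq, hqp, hd⟩⟩
    · rintro ⟨p, hp, hpS⟩
      obtain ⟨hpΛ, q, hq, hqp, hd⟩ := (hmemS X p hp).1 hpS
      exact ⟨p, hp, hpΛ, q, hq, hqp, hd⟩
  rw [key]
  exact hT (measurableSet_singleton 0)

/-- The superposition is the union of the thrown points restricted to `Λ × ℝᵈ` and of the boundary condition restricted
to `Λᶜ × ℝᵈ`. -/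
theorem superposeIn_eq_union (Λ : Set V3) {k : ℕ} (x : Fin k → V3 × V3) (Y : PointConfig (V3 × V3)) :
    superposeIn Λ x Y = (PointConfig.ofFn x).restrict (Prod.fst ⁻¹' Λ) ∪ Y.restrict (Prod.fst ⁻¹' Λᶜ) := by
  ext y
  rfl

/-- Membership in a superposition. -/
theorem mem_superposeIn_iff (Λ : Set V3) {k : ℕ} (x : Fin k → V3 × V3) (Y : PointConfig (V3 × V3)) (p : V3 × V3) :
    p ∈ superposeIn Λ x Y ↔ (p ∈ Set.range x ∧ p.1 ∈ Λ) ∨ (p ∈ Y ∧ p.1 ∉ Λ) :=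
  Iff.rfl

/-- The finite configuration `{x₁, …, x_k}` depends measurably on `x`. -/
theorem measurable_pointConfigOfFn (k : ℕ) : Measurable fun x : Fin k → V3 × V3 => PointConfig.ofFn x := by
  have h := (PointConfig.measurable_union_ofFn (E := V3 × V3) k).comp
    (measurable_id.prodMk (measurable_const (a := (∅ : PointConfig (V3 × V3)))))
  convert h using 1
  funext x
  ext y
  simp only [Function.comp_apply, id_eq, PointConfig.mem_union]
  constructor
  · exact fun hy => Or.inr hy
  · rintro (hy | hy)
    · exact absurd (show y ∈ (∅ : PointConfig (V3 × V3)).carrier from hy) (by simp)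
    · exact hy

/-- **Joint measurability of the superposition** `(x, Y) ↦ (x ∩ Λ) ∪ (Y ∩ Λᶜ)` for measurable `Λ`. -/
theorem measurable_superposeIn {Λ : Set V3} (hΛ : MeasurableSet Λ) (k : ℕ) :
    Measurable fun p : (Fin k → V3 × V3) × PointConfig (V3 × V3) => superposeIn Λ p.1 p.2 := by
  have hΛ' : MeasurableSet (Prod.fst ⁻¹' Λ : Set (V3 × V3)) := hΛ.preimage measurable_fst
  refine PointConfig.measurable_of_count fun s hs => ?_
  have hcount : ∀ p : (Fin k → V3 × V3) × PointConfig (V3 × V3), (superposeIn Λ p.1 p.2).count s =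
      (PointConfig.ofFn p.1).count (Prod.fst ⁻¹' Λ ∩ s) + p.2.count ((Prod.fst ⁻¹' Λ)ᶜ ∩ s) := fun p => by
    rw [superposeIn_eq_union, ← PointConfig.count_restrict, ← PointConfig.count_restrict]
    simp only [PointConfig.count, PointConfig.carrier_union, PointConfig.carrier_restrict, Set.union_inter_distrib_right]
    rw [Set.encard_union_eq (Set.disjoint_left.2 fun y (hy : y ∈ ((PointConfig.ofFn p.1).carrier ∩ Prod.fst ⁻¹' Λ) ∩ s)
      (hy' : y ∈ (p.2.carrier ∩ Prod.fst ⁻¹' Λᶜ) ∩ s) => hy'.1.2 hy.1.2)]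
    rfl
  simp_rw [hcount]
  have h1 : Measurable fun p : (Fin k → V3 × V3) × PointConfig (V3 × V3) =>
      (PointConfig.ofFn p.1).count (Prod.fst ⁻¹' Λ ∩ s) :=
    (PointConfig.measurable_count (hΛ'.inter hs)).comp ((measurable_pointConfigOfFn k).comp measurable_fst)
  have h2 : Measurable fun p : (Fin k → V3 × V3) × PointConfig (V3 × V3) => p.2.count ((Prod.fst ⁻¹' Λ)ᶜ ∩ s) :=
    (PointConfig.measurable_count (hΛ'.compl.inter hs)).comp measurable_snd
  exact (measurable_of_countable fun q : ℕ∞ × ℕ∞ => q.1 + q.2).comp (h1.prodMk h2)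

/-- For a fixed boundary condition, `x ↦ superposeIn Λ x Y` is measurable. -/
theorem measurable_superposeIn_left {Λ : Set V3} (hΛ : MeasurableSet Λ) (k : ℕ) (Y : PointConfig (V3 × V3)) :
    Measurable fun x : Fin k → V3 × V3 => superposeIn Λ x Y :=
  (measurable_superposeIn hΛ k).comp (measurable_id.prodMk measurable_const)

/-- The hard-core event of a superposition is jointly measurable in the thrown points and the boundary condition. -/
theorem measurableSet_hardCoreIn_superposeIn (ε : ℝ) {Λ : Set V3} (hΛ : MeasurableSet Λ) (k : ℕ) :
    MeasurableSet {p : (Fin k → V3 × V3) × PointConfig (V3 × V3) | HardCoreIn ε Λ (superposeIn Λ p.1 p.2)} :=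
  (measurableSet_hardCoreIn ε hΛ).preimage (measurable_superposeIn hΛ k)

/-- For a fixed boundary condition, the hard-core event is measurable in the thrown points. -/
theorem measurableSet_hardCoreIn_superposeIn_left (ε : ℝ) {Λ : Set V3} (hΛ : MeasurableSet Λ) (k : ℕ)
    (Y : PointConfig (V3 × V3)) : MeasurableSet {x : Fin k → V3 × V3 | HardCoreIn ε Λ (superposeIn Λ x Y)} :=
  (measurableSet_hardCoreIn ε hΛ).preimage (measurable_superposeIn_left hΛ k Y)

/-! ## Combinatorics of a superposition above the window -/

/-- At most `k` particles of `superposeIn Λ x Y` have position in `Λ` (the boundary condition is cut away from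
`Λ × ℝᵈ`, and coincident thrown points merge). -/
theorem count_superposeIn_prod_univ_le (Λ : Set V3) {k : ℕ} (x : Fin k → V3 × V3) (Y : PointConfig (V3 × V3)) :
    (superposeIn Λ x Y).count (Λ ×ˢ (univ : Set V3)) ≤ k := by
  classical
  have hsub : (superposeIn Λ x Y).carrier ∩ Λ ×ˢ (univ : Set V3) ⊆ ((Finset.univ.image x : Finset (V3 × V3)) : Set (V3 × V3)) := by
    rintro p ⟨hp, hpΛ⟩
    rw [Finset.coe_image, Finset.coe_univ, Set.image_univ]
    rcases (mem_superposeIn_iff Λ x Y p).1 hp with ⟨hpx, -⟩ | ⟨-, hpc⟩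
    · exact hpx
    · exact absurd hpΛ.1 hpc
  calc (superposeIn Λ x Y).count (Λ ×ˢ (univ : Set V3))
      ≤ ((Finset.univ.image x : Finset (V3 × V3)) : Set (V3 × V3)).encard := Set.encard_le_encard hsub
    _ = ((Finset.univ.image x).card : ℕ∞) := Set.encard_coe_eq_coe_finsetCard _
    _ ≤ k := by
        have h : (Finset.univ.image x).card ≤ k :=
          Finset.card_image_le.trans (by rw [Finset.card_univ, Fintype.card_fin])
        exact_mod_cast h

/-- If all thrown points have position in `Λ`, the particles of the superposition above `Λ` are exactly the thrown
points. -/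
theorem particlesIn_superposeIn_eq_range (Λ : Set V3) {k : ℕ} {x : Fin k → V3 × V3} (hx : ∀ i, (x i).1 ∈ Λ)
    (Y : PointConfig (V3 × V3)) : particlesIn (superposeIn Λ x Y) Λ = Set.range x := by
  ext p
  rw [mem_particlesIn_iff, mem_superposeIn_iff]
  constructor
  · rintro ⟨hp, hpΛ⟩
    rcases hp with ⟨hpx, -⟩ | ⟨-, hpc⟩
    · exact hpx
    · exact absurd hpΛ hpc
  · rintro ⟨i, rfl⟩
    exact ⟨Or.inl ⟨⟨i, rfl⟩, hx i⟩, hx i⟩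

/-- **The hard core of a superposition in coordinates**, for thrown points with positions in `Λ` and pairwise
distinct positions: the thrown points are mutually at position-distance `≥ ε`, and each is at position-distance
`≥ ε` from every boundary particle outside `Λ`. -/
theorem hardCoreIn_superposeIn_iff (ε : ℝ) (Λ : Set V3) {k : ℕ} {x : Fin k → V3 × V3} (hx : ∀ i, (x i).1 ∈ Λ)
    (hinj : ∀ i j, (x i).1 = (x j).1 → i = j) (Y : PointConfig (V3 × V3)) :
    HardCoreIn ε Λ (superposeIn Λ x Y) ↔
      (∀ i j, i ≠ j → ε ≤ ‖(x i).1 - (x j).1‖) ∧ (∀ i, ∀ q ∈ Y, q.1 ∉ Λ → ε ≤ ‖(x i).1 - q.1‖) := by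
  constructor
  · intro h
    refine ⟨fun i j hij => h _ (Or.inl ⟨⟨i, rfl⟩, hx i⟩) _ (Or.inl ⟨⟨j, rfl⟩, hx j⟩)
        (fun heq => hij (hinj i j (by rw [heq]))) (Or.inl (hx i)),
      fun i q hq hqΛ => h _ (Or.inl ⟨⟨i, rfl⟩, hx i⟩) _ (Or.inr ⟨hq, hqΛ⟩) ?_ (Or.inl (hx i))⟩
    intro heq
    exact hqΛ (heq ▸ hx i)
  · rintro ⟨h1, h2⟩ p hp q hq hpq hΛ
    rcases (mem_superposeIn_iff Λ x Y p).1 hp with ⟨⟨i, rfl⟩, hi⟩ | ⟨hpY, hpΛ⟩ <;>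
      rcases (mem_superposeIn_iff Λ x Y q).1 hq with ⟨⟨j, rfl⟩, hj⟩ | ⟨hqY, hqΛ⟩
    · exact h1 i j (fun hij => hpq (by rw [hij]))
    · exact h2 i _ hqY hqΛ
    · rw [norm_sub_rev]; exact h2 j _ hpY hpΛ
    · exact (hΛ.elim hpΛ hqΛ).elim

end HardCoreMeasurability

/-- Registered stub `stub_measurable_superposeIn_hardCoreIn` (line `FirstLemma`, helper of the wall sanity check
`stub_gibbsFastBiasVanishes`): the superposition `(x, Y) ↦ (x ∩ Λ) ∪ (Y ∩ Λᶜ)` is jointly measurable and the hard-core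
event in `Λ` is measurable, for every measurable window `Λ ⊆ ℝ³`. -/
theorem stub_measurable_superposeIn_hardCoreIn : ∀ (ε : ℝ) (Λ : Set V3), MeasurableSet Λ → MeasurableSet {X : PointConfig (V3 × V3) | HardCoreIn ε Λ X} ∧ ∀ k : ℕ, Measurable fun p : (Fin k → V3 × V3) × PointConfig (V3 × V3) => superposeIn Λ p.1 p.2 :=
  fun ε _ hΛ => ⟨measurableSet_hardCoreIn ε hΛ, fun k => measurable_superposeIn hΛ k⟩


end Summit.AtomisticToContinuum.HydrodynamicLimit.Theorems.KiferCompactification
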